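import Mathlib
import HarnessLib
import Summits.HubbardSuperconductivity.HubbardSuperconductivity.Theorems.KLProgrammeKLRegimeEngineTowerProfiles

/-!
# Route `KLProgramme` — crux K3 ENGINE (gen 8 engine-flow child stmt-HubbardSuperconductivity-20437 `KLRegimeEngineV17F2`), stub (b):
# the blocked-tower bookkeeping, part 3 — bridging the Grassmann suppliers' index sets and the scaling dictionary
# (E1 lead r2d-p2 g5, memo E1-TOWER-BLOCKED §4/§7)

Glue between the dimensional suppliers and the dimensionless hypotheses of `towerStep_le_profile`/`towerBorn_le_law` (part 2):

* `two_mul_add_le_sum_iff` — the leg constraint of `Literature.….sum_norm_kernel_effAction_sub_gaussConv_le_graded_of_gramBounded` (G1),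
  `2p + 2(n−1) ≤ Σ_a 2δ_a`, is `towerS`'s `p + n − 1 ≤ Σ_a δ_a` (`1 ≤ n`);
* **`sum_range_filter_prod_eq_towerS`** — G1 sums the degree assignments over `[0, D]^n` (`degs = range (D+1)`, `D = |Γ|/2`); with the
  degree-`0` size set to `0` (the interaction has no constant part, and the pinned-norm hypothesis is vacuous in degree `0`) the assignments
  with a zero entry drop out and the sum IS `towerS D τ μ n p` (index set `[1, D]^n`);  `sum_range_eq_sum_Icc_of_zero` — the same for
  the one-dimensional sums (`‖V‖_h`, first order);
* `exp_two_mul_two_kappa_sq` — `(e²(κ+κ))² = 4e⁴κ²` (with Mathlib's `pow_mul : w^{2m} = (w²)^m`, the suppliers' field weight per leg pair);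
* the SCALING DICTIONARY as identities: measuring the degree-`2m` sizes in units of `c^m` (`c = 8^J`: `2^{(3m−5)J} = 8^{mJ}·2^{−5J}`) multiplies
  `towerS`'s weight (`towerS_pow_mul : towerS D τ (m ↦ c^m μ m) n p = towerS D (τc) μ n p`), `towerV`'s weight (`towerV_pow_mul`), and the
  first order's Gram constant with the output unit pulled out (`towerFO_pow_mul : towerFO D σ (m ↦ c^m μ m) p = c^p · towerFO D (σc) μ p`) —
  so `σ = κ_Γ²·8^J`, `τ = (e²·2κ_Γ)²·8^J = 4e⁴κ_Γ²·8^J`, and the order-`n` prefactor `e(eα/κ²)^{n−1}κ^{−2p}` absorbs `8^{Jp}·2^{−5J(n−1)}`: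
  `ψ = κ_Γ^{−2}·8^{−J}`, `Φ = eα_Γ·2^{−5J}/κ_Γ²` (all `k`-independent at the tree's slice constants `κ_j² ∝ 8^{−j}`, `α_j ∝ 4^{j}`).

Pure finite-sum algebra; nothing about the model is asserted.
-/

noncomputable section

namespace Summit.HubbardSuperconductivity.HubbardSuperconductivity.Theorems.EngineV8

set_option linter.dupNamespace false -- summit = problem name (single-conjunct summit), D-0017

open Real Finset

/-! ## §1 Index sets: the suppliers' `[0, D]^n` with the leg constraint `2p + 2(n−1) ≤ Σ 2δ_a` versus `towerS` -/

/-- The leg constraint in G1's form is `towerS`'s: `2p + 2(n−1) ≤ Σ_a 2δ_a ↔ p + n − 1 ≤ Σ_a δ_a` for `1 ≤ n`. -/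
theorem two_mul_add_le_sum_iff {n : ℕ} (hn : 1 ≤ n) (p : ℕ) (δ : Fin n → ℕ) :
    2 * p + 2 * (n - 1) ≤ ∑ a, 2 * δ a ↔ p + n - 1 ≤ ∑ a, δ a := by
  rw [← mul_sum]
  omega

/-- **A product over an assignment with a zero entry vanishes** when the degree-`0` size is `0`. -/
theorem prod_pow_mul_eq_zero_of_exists_zero {n : ℕ} {τ : ℝ} {μ : ℕ → ℝ} (hμ0 : μ 0 = 0) {δ : Fin n → ℕ} (h : ∃ a, δ a = 0) :
    ∏ a, τ ^ (δ a) * μ (δ a) = 0 := by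
  obtain ⟨a, ha⟩ := h
  exact prod_eq_zero (mem_univ a) (by rw [ha, hμ0, mul_zero])

/-- **The suppliers' graded sum over `[0, D]^n` is `towerS`** (degree-`0` size `0`): for `1 ≤ n`,
`Σ_{δ ∈ [0,D]^n, 2p + 2(n−1) ≤ Σ 2δ_a} Π_a τ^{δ_a} μ(δ_a) = towerS D τ μ n p`. -/
theorem sum_range_filter_prod_eq_towerS {D n : ℕ} (hn : 1 ≤ n) {τ : ℝ} {μ : ℕ → ℝ} (hμ0 : μ 0 = 0) (p : ℕ) :
    ∑ δ ∈ (Fintype.piFinset fun _ : Fin n => range (D + 1)) with 2 * p + 2 * (n - 1) ≤ ∑ a, 2 * δ a,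
        ∏ a, τ ^ (δ a) * μ (δ a) = towerS D τ μ n p := by
  rw [towerS]
  symm
  refine sum_subset (fun δ hδ => ?_) (fun δ hδ hδ' => ?_)
  · rw [mem_filter, Fintype.mem_piFinset] at hδ ⊢
    exact ⟨fun a => mem_range.2 (Nat.lt_succ_of_le (mem_Icc.1 (hδ.1 a)).2), (two_mul_add_le_sum_iff hn p δ).2 hδ.2⟩
  · rw [mem_filter, Fintype.mem_piFinset] at hδ hδ'
    refine prod_pow_mul_eq_zero_of_exists_zero hμ0 ?_
    by_contra hne
    exact hδ' ⟨fun a => mem_Icc.2 ⟨Nat.pos_of_ne_zero fun h0 => hne ⟨a, h0⟩, Nat.le_of_lt_succ (mem_range.1 (hδ.1 a))⟩,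
      (two_mul_add_le_sum_iff hn p δ).1 hδ.2⟩

/-- The one-dimensional version: `Σ_{m ∈ [0, D]} w^m μ(m) = Σ_{m ∈ [1, D]} w^m μ(m)` when `μ 0 = 0` (for `‖V‖_h` and the first order). -/
theorem sum_range_eq_sum_Icc_of_zero {D : ℕ} {w : ℝ} {μ : ℕ → ℝ} (hμ0 : μ 0 = 0) :
    ∑ m ∈ range (D + 1), w ^ m * μ m = ∑ m ∈ Icc 1 D, w ^ m * μ m := by
  symm
  refine sum_subset (fun m hm => mem_range.2 (Nat.lt_succ_of_le (mem_Icc.1 hm).2)) (fun m hm hm' => ?_)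
  have h0 : m = 0 := by
    rw [mem_range] at hm
    rw [mem_Icc] at hm'
    omega
  rw [h0, hμ0, mul_zero]

/-- `(e²(κ+κ))² = 4e⁴κ²`: the graded input weight per leg pair at output radius `ρ = κ`. -/
theorem exp_two_mul_two_kappa_sq (κ : ℝ) : (exp 2 * (κ + κ)) ^ 2 = 4 * exp 4 * κ ^ 2 := by
  have h : exp 4 = exp 2 * exp 2 := by rw [← Real.exp_add]; norm_num
  rw [h]
  ring

/-! ## §2 The scaling dictionary as identities -/

/-- **Units in the graded sum**: sizes measured in units of `c^m` multiply the per-leg-pair weight,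
`towerS D τ (m ↦ c^m μ m) n p = towerS D (τ·c) μ n p`. -/
theorem towerS_pow_mul (D : ℕ) (τ c : ℝ) (μ : ℕ → ℝ) (n p : ℕ) :
    towerS D τ (fun m => c ^ m * μ m) n p = towerS D (τ * c) μ n p := by
  unfold towerS
  refine sum_congr rfl fun δ _ => prod_congr rfl fun a _ => ?_
  rw [mul_pow]
  ring

/-- **Units in the field-weighted norm**: `towerV D τ (m ↦ c^m μ m) = towerV D (τ·c) μ`. -/
theorem towerV_pow_mul (D : ℕ) (τ c : ℝ) (μ : ℕ → ℝ) :
    towerV D τ (fun m => c ^ m * μ m) = towerV D (τ * c) μ := by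
  unfold towerV
  refine sum_congr rfl fun m _ => ?_
  rw [mul_pow, mul_pow]
  ring

/-- **Units in the first order**: `towerFO D σ (m ↦ c^m μ m) p = c^p · towerFO D (σ·c) μ p` (the `m − p` contracted pairs take `(σc)`, the
`p` surviving pairs the output unit `c^p`). -/
theorem towerFO_pow_mul (D : ℕ) (σ c : ℝ) (μ : ℕ → ℝ) (p : ℕ) :
    towerFO D σ (fun m => c ^ m * μ m) p = c ^ p * towerFO D (σ * c) μ p := by
  unfold towerFO
  rw [mul_sum]
  refine sum_congr rfl fun m hm => ?_
  have hpm : p ≤ m := (mem_Ioc.1 hm).1.le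
  obtain ⟨q, rfl⟩ := Nat.exists_eq_add_of_le hpm
  dsimp only
  rw [Nat.add_sub_cancel_left, mul_pow, pow_add]
  ring

/-- **The dimensional unit of the (E1) law factorises**: `2^{(3m−5)J} = (8^J)^m · (2^{5J})⁻¹` — the degree-`2m` sizes are measured in units
of `c^m` with `c = 8^J`, up to the degree-independent `2^{−5J}` (which the order-`n` prefactor absorbs: `Φ = eα·2^{−5J}/κ²`). -/
theorem two_zpow_law_eq (m J : ℕ) :
    (2 : ℝ) ^ ((3 * (m : ℤ) - 5) * J) = ((8 : ℝ) ^ J) ^ m * ((2 : ℝ) ^ (5 * J))⁻¹ := by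
  have hsplit : ((3 * (m : ℤ) - 5) * J) = ((3 * m * J : ℕ) : ℤ) + -((5 * J : ℕ) : ℤ) := by push_cast; ring
  rw [hsplit, zpow_add₀ (by norm_num), zpow_neg, zpow_natCast, zpow_natCast]
  congr 1
  rw [show (8 : ℝ) = 2 ^ 3 by norm_num, ← pow_mul, ← pow_mul]
  congr 1
  ring

end Summit.HubbardSuperconductivity.HubbardSuperconductivity.Theorems.EngineV8

end
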